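import Literature.AlgebraicGeometry.HodgeTheory.PicardLefschetzSymmetricA3OfUniform
import Literature.AlgebraicGeometry.HodgeTheory.PicardLefschetzNodalFormsFlatShapes
import HarnessLib

/-!
# The Picard–Lefschetz pair data of the symmetric `A₃` unfolding from the FLAT nodal package (no sign rule, no exchange rule)

Family `hodge`, layer `Literature/AlgebraicGeometry/HodgeTheory`; proof file (theorems only: no definition, no named fact, no
`sorry`).  Written by the prover seat `hodge-nonav-19716-p2` (g10, cell `hodge-nonav`), programme «W-ELIM» brick 4, for crux K1-B
`VeryGeneralSignCommutatorsInHg` (`Summits/HodgeConjecture/HodgeConjecture/Theses/SignSymmetricPowers.lean`, stmt-HodgeConjecture-19716).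
VERBATIM twin of `PicardLefschetzSymmetricA3OfUniform.symmetricA3PicardLefschetzPair_of_uniform` (g9) with the hypothesis
`picardLefschetz_nodalForms_uniform` WEAKENED to `picardLefschetz_nodalForms_flat` (`PicardLefschetzNodalFormsFlat`): the g9
proof used the uniform package only through «Picard–Lefschetz data at any radius», which holds for the flat package
(`picardLefschetz_nodalForms_flat.exists_isPicardLefschetzData_of_radius`) — the equivariance clause was never used.

* `symmetricA3PicardLefschetzPair_of_flat` — **(P1) ∧ (P2) ⟸ hPL-flat**: inside every bifurcation datum of a symmetric
  `A₃` datum, on the radius of `IsSymmetricA3Bifurcation.exists_radius_eval_g₀_ne`, the two circles of hB2 at the midpoint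
  base point carry Picard–Lefschetz data `![e₂]` and `![e₁, e₃]` with the COMMON flat coefficient `c(t₀)`
  (`SymmetricA3PicardLefschetzPair`).

CONDITIONAL plumbing (the flat package is a named fact); nothing here proves HC; rung F-H1 is not moved.

References: [VoisinHodgeII2003] Voisin, *Hodge Theory and Complex Algebraic Geometry II*, §2.3.1, §3.1.2, §3.2.1 Thm. 3.16,
§3.2.2; [ArnoldGuseinzadeVarchenko2012] AGZV II, Part I §1.3, §5.2 (pp. 129–133).
-/

noncomputable section

open CategoryTheory AlgebraicGeometry MvPolynomial Filter Topology
open Literature.AlgebraicTopology.SingularHomology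
open Literature.AlgebraicGeometry.Motives Literature.AlgebraicGeometry.Motives.UniversalHypersurface

namespace Literature.AlgebraicGeometry.HodgeTheory

section HodgeTheory

variable {n d : ℕ} {f₁ g₀ g₂ : MvPolynomial (Fin (n + 2)) ℂ} {j k : Fin (n + 2)} {a : Fin (n + 2) → ℂˣ}
  {εa εb : ℝ} {ψ : ℂ → ℂ}

/-! ### §1 (P1) ∧ (P2) from the FLAT nodal Picard–Lefschetz package (no equivariance clause) -/

/-- `(r * E) • g = (((1 : ℝ) : ℂ) * E) • (r • g)`: the complex-radius circle as the radius-`1` circle of the rescaled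
co-pencil form. [cite: VoisinHodgeII2003, §2.3.1] -/
private theorem smul_rescale (r E : ℂ) (g : MvPolynomial (Fin (n + 2)) ℂ) :
    (r * E) • g = (((1 : ℝ) : ℂ) * E) • (r • g) := by
  rw [smul_smul, Complex.ofReal_one, one_mul, mul_comm]

/-- **(P1) ∧ (P2) ⟸ hPL-flat.**  For a symmetric `A₃` datum, a bifurcation datum `(εa, εb, ψ)`, and the radius of
`IsSymmetricA3Bifurcation.exists_radius_eval_g₀_ne`: granted ONLY the flat package `picardLefschetz_nodalForms_flat` (no sign
rule, no exchange rule), the two circles of hB2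
at the midpoint base point carry Picard–Lefschetz data `![e₂]` (one node `e_j` of `f₁ + a'g₂`, pencil direction
`(ψ a'/2)·g₀`, radius `1`) and `![e₁, e₃]` (the two nodes of `f₁ + a'g₂ + ψ(a')g₀`, direction `−(ψ a'/2)·g₀`, radius `1`)
with the COMMON coefficient `c(t₀)` of the flat Picard–Lefschetz coefficient — `SymmetricA3PicardLefschetzPair`.  The
punctured unit discs of both pencils are nonsingular by the bifurcation clauses (`|b| ≤ |ψ|/2 < |ψ|`, resp.
`b = ψ(1 − c'/2)` with `0 < |c'| ≤ 1`, and `2|ψ| < εb`).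
[cite: VoisinHodgeII2003, §3.2.1 Thm. 3.16, §3.2.2 and §2.3.1] [cite: ArnoldGuseinzadeVarchenko2012, Part I §5.2] -/
theorem symmetricA3PicardLefschetzPair_of_flat (H : picardLefschetz_nodalForms_flat)
    (hf₁ : f₁.IsHomogeneous d) (hg₀ : g₀.IsHomogeneous d) (hg₂ : g₂.IsHomogeneous d)
    (hD : IsSymmetricA3Datum f₁ g₀ g₂ j k a) (hB : IsSymmetricA3Bifurcation f₁ g₀ g₂ j a εa εb ψ) :
    ∃ εa' : ℝ, 0 < εa' ∧ εa' ≤ εa ∧ SymmetricA3PicardLefschetzPair n d f₁ g₀ g₂ ψ εa' := by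
  obtain ⟨εa', hεa', hle, hgood⟩ := hB.exists_radius_eval_g₀_ne hf₁ hg₀ hg₂ hD
  refine ⟨εa', hεa', hle, fun hn hd hU a' ha ha0 t₀ ht₀ γ₁ γ₂ hγ₁ hγ₂ => ?_⟩
  have haεa : ‖a'‖ < εa := lt_of_lt_of_le ha hle
  obtain ⟨c, hc, hPLr⟩ := H.exists_isPicardLefschetzData_of_radius n d hn hd hU
  -- the bifurcation clauses at `a'`
  have hψne : ψ a' ≠ 0 := hB.2.2.2.2.1 a' haεa ha0
  have hψb : 2 * ‖ψ a'‖ < εb := hB.2.2.2.2.2.1 a' haεa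
  have hψpos : 0 < ‖ψ a'‖ := norm_pos_iff.2 hψne
  obtain ⟨hnod₁, q, hnod₂, -⟩ := hB.2.2.2.2.2.2.2 a' haεa ha0
  -- the two pencils: `F₁ + c'G₁` with `F₁ = f₁ + a'g₂`, `G₁ = (ψ/2)g₀`; `F₂ + c'G₂` with `F₂ = F₁ + ψ g₀`, `G₂ = -(ψ/2)g₀`
  have hF₁h : (f₁ + a' • g₂).IsHomogeneous d := isHomogeneous_add_smul hf₁ hg₂ a'
  have hF₂h : (f₁ + a' • g₂ + ψ a' • g₀).IsHomogeneous d := isHomogeneous_add_smul hF₁h hg₀ _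
  have hG₁h : ((ψ a' / 2) • g₀).IsHomogeneous d := by
    simpa using isHomogeneous_add_smul (isHomogeneous_zero _ _ d) hg₀ (ψ a' / 2)
  have hG₂h : ((-(ψ a' / 2)) • g₀).IsHomogeneous d := by
    simpa using isHomogeneous_add_smul (isHomogeneous_zero _ _ d) hg₀ (-(ψ a' / 2))
  have hline₁ : ∀ c' : ℂ, f₁ + a' • g₂ + c' • ((ψ a' / 2) • g₀) = f₁ + a' • g₂ + (c' * (ψ a' / 2)) • g₀ :=
    fun c' => by rw [smul_smul]
  have hline₂ : ∀ c' : ℂ, f₁ + a' • g₂ + ψ a' • g₀ + c' • ((-(ψ a' / 2)) • g₀) =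
      f₁ + a' • g₂ + (ψ a' - c' * (ψ a' / 2)) • g₀ := fun c' => by
    rw [smul_smul, sub_smul, mul_neg, neg_smul]; abel
  -- nonsingularity of the punctured unit discs
  have hbnd : ∀ c' : ℂ, ‖c'‖ ≤ 1 → ‖c' * (ψ a' / 2)‖ ≤ ‖ψ a'‖ / 2 := fun c' hc1 => by
    rw [norm_mul, norm_div, Complex.norm_two]
    nlinarith [norm_nonneg (ψ a'), norm_nonneg c']
  have hns₁ : ∀ c' : ℂ, c' ≠ 0 → ‖c'‖ ≤ 1 →
      SmoothHypersurface.IsNonsingularForm ℂ (f₁ + a' • g₂ + c' • ((ψ a' / 2) • g₀)) := by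
    intro c' hc' hc1
    have hb := hbnd c' hc1
    rw [hline₁]
    refine hB.isNonsingularForm haεa (by linarith) (mul_ne_zero hc' (div_ne_zero hψne two_ne_zero)) ?_
    intro h
    rw [h] at hb
    linarith
  have hns₂ : ∀ c' : ℂ, c' ≠ 0 → ‖c'‖ ≤ 1 →
      SmoothHypersurface.IsNonsingularForm ℂ (f₁ + a' • g₂ + ψ a' • g₀ + c' • ((-(ψ a' / 2)) • g₀)) := by
    intro c' hc' hc1
    have hb := hbnd c' hc1
    rw [hline₂]
    refine hB.isNonsingularForm haεa ?_ ?_ ?_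
    · calc ‖ψ a' - c' * (ψ a' / 2)‖ ≤ ‖ψ a'‖ + ‖c' * (ψ a' / 2)‖ := norm_sub_le _ _
        _ < εb := by linarith
    · intro h
      rw [sub_eq_zero] at h
      rw [← h] at hb
      linarith
    · intro h
      have h' : c' * (ψ a' / 2) = 0 := by linear_combination -h
      exact mul_ne_zero hc' (div_ne_zero hψne two_ne_zero) h'
  -- the co-pencil forms miss the nodes
  have hG₁e : ∀ i : Fin 1, eval ((![Pi.single j (1 : ℂ)] : Fin 1 → Fin (n + 2) → ℂ) i) ((ψ a' / 2) • g₀) ≠ 0 := by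
    intro i
    fin_cases i
    simp only [smul_eval, Matrix.cons_val_fin_one]
    exact mul_ne_zero (div_ne_zero hψne two_ne_zero) hD.eval_g₀_ne
  have hG₂q : ∀ i : Fin 2, eval (q i) ((-(ψ a' / 2)) • g₀) ≠ 0 := by
    intro i
    rw [smul_eval]
    refine mul_ne_zero (neg_ne_zero.2 (div_ne_zero hψne two_ne_zero)) ?_
    exact hgood a' ha (q i) (hnod₂.1 i).ne_zero (hnod₂.1 i).eval_pderiv
  -- the base point and the circles in the radius-`1` idiom
  have ht₁ : pointForm ℂ n d t₀ = f₁ + a' • g₂ + ((1 : ℝ) : ℂ) • ((ψ a' / 2) • g₀) := by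
    rw [ht₀, Complex.ofReal_one, one_smul]
  have ht₂ : pointForm ℂ n d t₀ = f₁ + a' • g₂ + ψ a' • g₀ + ((1 : ℝ) : ℂ) • ((-(ψ a' / 2)) • g₀) := by
    rw [ht₀, hline₂]
    congr 2
    rw [Complex.ofReal_one]
    ring
  have hc₁ : IsPencilCircle n d (f₁ + a' • g₂) ((ψ a' / 2) • g₀) 1 γ₁ := fun θ => by
    rw [hγ₁ θ, ← smul_rescale]
  have hc₂ : IsPencilCircle n d (f₁ + a' • g₂ + ψ a' • g₀) ((-(ψ a' / 2)) • g₀) 1 γ₂ := fun θ => by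
    rw [hγ₂ θ, hline₂, Complex.ofReal_one, one_mul, mul_comm]
  -- the Picard–Lefschetz data, both with the coefficient `c t₀`
  obtain ⟨δ₁, hPL₁⟩ := hPLr 1 _ _ hF₁h hG₁h _ hnod₁ hG₁e 1 one_pos hns₁ t₀ ht₁ γ₁ hc₁
  obtain ⟨δ₂, hPL₂⟩ := hPLr 2 _ _ hF₂h hG₂h q hnod₂ hG₂q 1 one_pos hns₂ t₀ ht₂ γ₂ hc₂
  have e₁ : (![δ₁ 0] : Fin 1 → bettiCohomology (fiberOver (family ℂ n d) t₀) n) = δ₁ := by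
    funext i; fin_cases i; rfl
  have e₂ : (![δ₂ 0, δ₂ 1] : Fin 2 → bettiCohomology (fiberOver (family ℂ n d) t₀) n) = δ₂ := by
    funext i; fin_cases i <;> rfl
  exact ⟨c t₀, δ₂ 0, δ₁ 0, δ₂ 1, e₁ ▸ hPL₁, e₂ ▸ hPL₂⟩

end HodgeTheory

end Literature.AlgebraicGeometry.HodgeTheory

end
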